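import Summits.QuantumFields.YangMills.Theorems.ColdStartUniversalityLatticeLangevinCasimirTwo
import Summits.QuantumFields.YangMills.Theorems.ColdStartUniversalityLatticeLangevinTaylorData
import Mathlib.Analysis.Calculus.FDeriv.Bilinear
import HarnessLib

/-!
# Route `ColdStartUniversality`, crux K_A1 `UniformColdStartMixing` (stmt-QuantumFields-24809), rung `stub_fixedCutoffMixing`:
# the coordinate generator of the SU(2) lattice Langevin dynamics on latitude (ridge) functions

Helper file (seat `ym-line-csu-p1`, g7).  For directions `g : Edge 3 L → SU(2)` the **latitude map** sends the real link
coordinates `y` (Re/Im of the matrix entries, the coordinates of `dynkin_expectation_szz`) to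
`(⟨ρ(g_e), Q_e⟩)_e`, `⟨X, Y⟩ = ½ Re tr(X Yᴴ)` the inner product of `ℝ⁴ ≅ ℍ ⊇ SU(2) = S³` — a linear map.  For a `C²`
function `Φ` of the latitudes and `f = Φ ∘ lat`, the integrand of `dynkin_expectation_szz` (the coordinate generator
`Σᵢ ∂ᵢf bᵢ + ½ Σᵢⱼ ∂ᵢⱼf (σσᵀ)ᵢⱼ` of the SZZ system at coupling `β`) evaluated at a configuration `V ∈ SU(2)^E` equals

  `Σ_e [ ½ (1 - s_e²) ∂²_{ee} Φ(s) + ( -3/2 · s_e + ½ ⟨ρ(g_e), driftLie_e(Q) Q_e⟩_{HS} ) ∂_e Φ(s) ]`,  `s_e = ⟨ρ(g_e), ρ(V_e)⟩`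

(`generator_latitude`): at `β = 0` this is the Jacobi operator `½[(1 - s²) ∂² - 3 s ∂]` in each latitude — the radial part
of `½ Δ_{S³}`, whose eigenfunctions are the Chebyshev polynomials `U_n` (`(1-s²)U_n'' - 3 s U_n' = -n(n+2) U_n`).
Ingredients: the chain rule through the linear latitude map, the noise covariance `Σₙ ⟨ρ g, 𝐩(Eₙ) ρ u⟩² = 2(1 - s²)` and the
Casimir-free form of the drift (`…LatitudeAlgebra`; the Casimir enters through `hsForm_casimir_two_mul` of
`…CasimirTwo`).  No definition, no sorry.  RECORD-rung R3 plumbing; nothing here bears on the mass gap.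
-/

set_option autoImplicit false

noncomputable section

namespace Summit.QuantumFields.YangMills.Theorems.ColdStartUniversality

open Matrix Complex Finset
open scoped ComplexConjugate BigOperators
open Literature.MathematicalPhysics.QuantumFieldTheory
open Literature.MathematicalPhysics.QuantumLattice (fundamentalRep fundamentalLatticeRep)

variable {L : ℕ}

/-! ### Real link coordinates and the latitude map -/

/-- **The latitude map is linear**: `y ↦ (½ Σᵢⱼ (Re G_e ij · y(e,i,j,re) + Im G_e ij · y(e,i,j,im)))_e` is a continuous
linear map (given here as `ContinuousLinearMap.pi` of coordinate combinations). [folklore] -/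
theorem latitude_eq_clm (G : Edge 3 L → Matrix (Fin 2) (Fin 2) ℂ) :
    ∃ ℓ : ((Edge 3 L × Fin 2 × Fin 2 × Bool) → ℝ) →L[ℝ] (Edge 3 L → ℝ),
      ∀ y e, ℓ y e = (∑ i, ∑ j, ((G e i j).re * y (e, i, j, false) + (G e i j).im * y (e, i, j, true))) / 2 := by
  classical
  refine ⟨ContinuousLinearMap.pi fun e => (1 / 2 : ℝ) • ∑ i : Fin 2, ∑ j : Fin 2,
    ((G e i j).re • ContinuousLinearMap.proj (R := ℝ) (φ := fun _ : Edge 3 L × Fin 2 × Fin 2 × Bool => ℝ)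
        (e, i, j, false) +
      (G e i j).im • ContinuousLinearMap.proj (R := ℝ) (φ := fun _ : Edge 3 L × Fin 2 × Fin 2 × Bool => ℝ)
        (e, i, j, true)), fun y e => ?_⟩
  simp only [ContinuousLinearMap.pi_apply, _root_.smul_apply, _root_.sum_apply, _root_.add_apply,
    ContinuousLinearMap.proj_apply, smul_eq_mul]
  ring

/-- **The latitude map on the coordinates of a matrix configuration** `M : Edge → M₂(ℂ)`:
`lat(coords M)_e = ½ Re tr(G_e M_eᴴ) = ½ hsForm 2 G_e M_e`. [folklore] -/
theorem latitude_coords (G M : Edge 3 L → Matrix (Fin 2) (Fin 2) ℂ) (e : Edge 3 L) :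
    (∑ i, ∑ j, ((G e i j).re * (fun q : Edge 3 L × Fin 2 × Fin 2 × Bool =>
        (fun z : ℂ => if q.2.2.2 then z.im else z.re) (M q.1 q.2.1 q.2.2.1)) (e, i, j, false) +
      (G e i j).im * (fun q : Edge 3 L × Fin 2 × Fin 2 × Bool =>
        (fun z : ℂ => if q.2.2.2 then z.im else z.re) (M q.1 q.2.1 q.2.2.1)) (e, i, j, true))) / 2 =
      hsForm 2 (G e) (M e) / 2 := by
  rw [hsForm_eq_sum_entries]
  congr 1
  refine Finset.sum_congr rfl fun i _ => Finset.sum_congr rfl fun j _ => ?_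
  simp only [Bool.false_eq_true, if_false, if_true, Complex.mul_re, Complex.conj_re, Complex.conj_im]
  ring

/-! ### Calculus through a linear map -/

section Calculus

variable {E F : Type} [NormedAddCommGroup E] [NormedSpace ℝ E] [NormedAddCommGroup F] [NormedSpace ℝ F]

/-- Chain rule through a continuous linear map: `D(Φ ∘ ℓ)(y) v = DΦ(ℓ y) (ℓ v)` for differentiable `Φ`. [folklore] -/
theorem fderiv_comp_clm_apply {Φ : F → ℝ} (hΦ : Differentiable ℝ Φ) (ℓ : E →L[ℝ] F) (y v : E) :
    fderiv ℝ (fun z => Φ (ℓ z)) y v = fderiv ℝ Φ (ℓ y) (ℓ v) := by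
  have h : HasFDerivAt (fun z => Φ (ℓ z)) ((fderiv ℝ Φ (ℓ y)).comp ℓ) y :=
    (hΦ (ℓ y)).hasFDerivAt.comp y ℓ.hasFDerivAt
  rw [h.fderiv, ContinuousLinearMap.comp_apply]

/-- The derivative of `s ↦ DΦ(s) u` is `w ↦ D²Φ(s) w u` for `C²` functions. [folklore] -/
theorem fderiv_fderiv_apply_const {Φ : F → ℝ} (hΦ : ContDiff ℝ 2 Φ) (s₀ u w : F) :
    fderiv ℝ (fun s => fderiv ℝ Φ s u) s₀ w = fderiv ℝ (fderiv ℝ Φ) s₀ w u := by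
  have hd : DifferentiableAt ℝ (fderiv ℝ Φ) s₀ :=
    ((hΦ.fderiv_right (m := 1) (by norm_num)).differentiable (by norm_num)).differentiableAt
  rw [fderiv_clm_apply hd (differentiableAt_const u)]
  simp [ContinuousLinearMap.flip_apply]

/-- Second derivative of `Φ ∘ ℓ` along coordinate directions:
`D[z ↦ D(Φ ∘ ℓ)(z) eᵢ](y) eⱼ = D²Φ(ℓ y) (ℓ eⱼ) (ℓ eᵢ)`. [folklore] -/
theorem fderiv_fderiv_comp_clm_apply {Φ : F → ℝ} (hΦ : ContDiff ℝ 2 Φ) (ℓ : E →L[ℝ] F) (y v w : E) :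
    fderiv ℝ (fun z => fderiv ℝ (fun z' => Φ (ℓ z')) z v) y w = fderiv ℝ (fderiv ℝ Φ) (ℓ y) (ℓ w) (ℓ v) := by
  have hΦd : Differentiable ℝ Φ := hΦ.differentiable (by norm_num)
  have h1 : (fun z => fderiv ℝ (fun z' => Φ (ℓ z')) z v) = fun z => (fun s => fderiv ℝ Φ s (ℓ v)) (ℓ z) := by
    funext z; exact fderiv_comp_clm_apply hΦd ℓ z v
  rw [h1]
  have hψ : Differentiable ℝ (fun s => fderiv ℝ Φ s (ℓ v)) := by
    have hd : Differentiable ℝ (fderiv ℝ Φ) := (hΦ.fderiv_right (m := 1) (by norm_num)).differentiable (by norm_num)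
    exact (ContinuousLinearMap.apply ℝ ℝ (ℓ v)).differentiable.comp hd
  rw [fderiv_comp_clm_apply hψ ℓ y w, fderiv_fderiv_apply_const hΦ]

/-- A continuous bilinear form on finite linear combinations:
`B (Σⱼ cⱼ uⱼ) (Σᵢ cᵢ uᵢ) = Σᵢ Σⱼ cᵢ cⱼ B uⱼ uᵢ`. [folklore] -/
theorem bilin_sum_smul_sum_smul {ι : Type} [Fintype ι] (B : F →L[ℝ] F →L[ℝ] ℝ) (u : ι → F) (c : ι → ℝ) :
    B (∑ j, c j • u j) (∑ i, c i • u i) = ∑ i, ∑ j, c i * c j * B (u j) (u i) := by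
  have h1 : B (∑ j, c j • u j) = ∑ j, c j • B (u j) := by
    rw [map_sum]
    exact Finset.sum_congr rfl fun j _ => by rw [map_smul]
  rw [h1, _root_.sum_apply]
  simp_rw [_root_.smul_apply, map_sum, map_smul, smul_eq_mul, Finset.mul_sum]
  rw [Finset.sum_comm]
  exact Finset.sum_congr rfl fun i _ => Finset.sum_congr rfl fun j _ => by ring

end Calculus

/-! ### The generator on latitude functions -/

/-- **The coordinate generator of the SU(2) lattice Langevin dynamics on a latitude function.**  For directions
`g : Edge 3 L → SU(2)`, a configuration `V ∈ SU(2)^E`, a `C²` function `Φ` of the latitudes and `f = Φ ∘ lat`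
(`lat y = (½ hsForm 2 ρ(g_e) (matrix of y at e))_e`, linear in the real link coordinates `y`), the integrand of
`dynkin_expectation_szz` at the coordinates `x` of `V` — `Σᵢ ∂ᵢf(x) bᵢ + ½ Σᵢⱼ ∂ᵢⱼf(x) Σₙ σᵢₙ σⱼₙ` with the SZZ drift and
noise at coupling `β` — equals
`Σ_e [½ (1 - s_e²) ∂²_{ee}Φ(s) + (-3/2 · s_e + ½ ⟨ρ(g_e), driftLie_e ρ(V_e)⟩) ∂_eΦ(s)]`, `s_e = ½ ⟨ρ(g_e), ρ(V_e)⟩ = lat(x)_e`.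
At `β = 0` (`driftLie = 0`) this is the Jacobi operator `½[(1 - s²)∂² - 3 s ∂]` latitude by latitude.
[cite: ShenZhuZhu2022, §3 Lemma 3.1 and the SDE system following it] -/
theorem generator_latitude [NeZero L] (β : ℝ) (g V : Edge 3 L → Matrix.specialUnitaryGroup (Fin 2) ℂ)
    {Φ : (Edge 3 L → ℝ) → ℝ} (hΦ : ContDiff ℝ 2 Φ) :
    let x : (Edge 3 L × Fin 2 × Fin 2 × Bool) → ℝ := fun q =>
      (fun z : ℂ => if q.2.2.2 then z.im else z.re)
        ((fundamentalRep (Fin 2) (V q.1) : Matrix (Fin 2) (Fin 2) ℂ) q.2.1 q.2.2.1)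
    let b : (Edge 3 L × Fin 2 × Fin 2 × Bool) → ℝ := fun q =>
      (fun z : ℂ => if q.2.2.2 then z.im else z.re) ((latticeLangevinDynamics (fundamentalLatticeRep 2) β).drift
        (matrixConfig (fundamentalRep (Fin 2)) V) q.1 q.2.1 q.2.2.1)
    let σ : (Edge 3 L × Fin 2 × Fin 2 × Bool) → (Edge 3 L × NoiseIdx 2) → ℝ := fun q k =>
      if k.1 = q.1 then (fun z : ℂ => if q.2.2.2 then z.im else z.re)
        ((latticeLangevinDynamics (fundamentalLatticeRep 2) β).noise
          (matrixConfig (fundamentalRep (Fin 2)) V) q.1 k.2 q.2.1 q.2.2.1) else 0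
    let lat : ((Edge 3 L × Fin 2 × Fin 2 × Bool) → ℝ) → (Edge 3 L → ℝ) := fun y e =>
      (∑ i, ∑ j, (((fundamentalRep (Fin 2) (g e) : Matrix (Fin 2) (Fin 2) ℂ) i j).re * y (e, i, j, false) +
        ((fundamentalRep (Fin 2) (g e) : Matrix (Fin 2) (Fin 2) ℂ) i j).im * y (e, i, j, true))) / 2
    let f : ((Edge 3 L × Fin 2 × Fin 2 × Bool) → ℝ) → ℝ := fun y => Φ (lat y)
    let s : Edge 3 L → ℝ := fun e => hsForm 2 (fundamentalRep (Fin 2) (g e)) (fundamentalRep (Fin 2) (V e)) / 2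
    lat x = s ∧
    (∑ i, fderiv ℝ f x (Pi.single i 1) * b i +
      (1 / 2) * ∑ i, ∑ j, fderiv ℝ (fun z => fderiv ℝ f z (Pi.single i 1)) x (Pi.single j 1) * ∑ n, σ i n * σ j n) =
    ∑ e, ((1 / 2) * (1 - s e ^ 2) * fderiv ℝ (fun z => fderiv ℝ Φ z (Pi.single e 1)) s (Pi.single e 1) +
      (-(3 / 2) * s e + hsForm (fundamentalLatticeRep 2).N ((fundamentalLatticeRep 2).ρ (g e))
        ((fundamentalLatticeRep 2).driftLie β (matrixConfig (fundamentalLatticeRep 2).ρ V) e *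
          (fundamentalLatticeRep 2).ρ (V e)) / 2) * fderiv ℝ Φ s (Pi.single e 1)) := by
  intro x b σ lat f s
  classical
  -- the latitude map as a continuous linear map
  obtain ⟨ℓ, hℓ⟩ := latitude_eq_clm (L := L) (fun e => (fundamentalRep (Fin 2) (g e) : Matrix (Fin 2) (Fin 2) ℂ))
  have hlat : lat = ⇑ℓ := by funext y e; exact (hℓ y e).symm
  -- `lat` on coordinates of matrix configurations
  have hlatM : ∀ (M : Edge 3 L → Matrix (Fin 2) (Fin 2) ℂ) (e : Edge 3 L),
      ℓ (fun q => (fun z : ℂ => if q.2.2.2 then z.im else z.re) (M q.1 q.2.1 q.2.2.1)) e =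
        hsForm 2 (fundamentalRep (Fin 2) (g e)) (M e) / 2 := by
    intro M e
    rw [hℓ]
    exact latitude_coords (fun e => (fundamentalRep (Fin 2) (g e) : Matrix (Fin 2) (Fin 2) ℂ)) M e
  have hxs : lat x = s := by
    rw [hlat]; funext e
    exact hlatM (fun e => (fundamentalRep (Fin 2) (V e) : Matrix (Fin 2) (Fin 2) ℂ)) e
  refine ⟨hxs, ?_⟩
  have hΦd : Differentiable ℝ Φ := hΦ.differentiable (by norm_num)
  have hf : f = fun y => Φ (ℓ y) := by funext y; simp only [f, hlat]
  -- first derivatives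
  have h1 : ∀ i, fderiv ℝ f x (Pi.single i 1) = fderiv ℝ Φ s (ℓ (Pi.single i 1)) := by
    intro i; rw [hf, fderiv_comp_clm_apply hΦd ℓ, ← hlat, hxs]
  -- second derivatives
  set D2 := fderiv ℝ (fderiv ℝ Φ) s with hD2
  have h2 : ∀ i j, fderiv ℝ (fun z => fderiv ℝ f z (Pi.single i 1)) x (Pi.single j 1) =
      D2 (ℓ (Pi.single j 1)) (ℓ (Pi.single i 1)) := by
    intro i j; rw [hf, fderiv_fderiv_comp_clm_apply hΦ ℓ, ← hlat, hxs]
  simp_rw [h1, h2]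
  -- FIRST-ORDER PART: `Σᵢ DΦ(s)(ℓ eᵢ) bᵢ = DΦ(s)(ℓ b) = Σ_e (ℓ b)_e ∂_eΦ(s)`
  have hfirst : ∑ i, fderiv ℝ Φ s (ℓ (Pi.single i 1)) * b i = fderiv ℝ Φ s (ℓ b) := by
    have hb : b = ∑ i, b i • (Pi.single i 1 : (Edge 3 L × Fin 2 × Fin 2 × Bool) → ℝ) := pi_eq_sum_univ' b
    conv_rhs => rw [hb, map_sum, map_sum]
    refine Finset.sum_congr rfl fun i _ => ?_
    rw [map_smul, map_smul, smul_eq_mul, mul_comm]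
  have hℓb : ∀ e, ℓ b e = -(3 / 2) * s e + hsForm (fundamentalLatticeRep 2).N ((fundamentalLatticeRep 2).ρ (g e))
      ((fundamentalLatticeRep 2).driftLie β (matrixConfig (fundamentalLatticeRep 2).ρ V) e *
        (fundamentalLatticeRep 2).ρ (V e)) / 2 := by
    intro e
    have h := hlatM ((latticeLangevinDynamics (fundamentalLatticeRep 2) β).drift
      (matrixConfig (fundamentalRep (Fin 2)) V)) e
    rw [h]
    have hd : hsForm (fundamentalLatticeRep 2).N ((fundamentalLatticeRep 2).ρ (g e))
        ((latticeLangevinDynamics (fundamentalLatticeRep 2) β).drift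
          (matrixConfig (fundamentalLatticeRep 2).ρ V) e) =
        hsForm (fundamentalLatticeRep 2).N ((fundamentalLatticeRep 2).ρ (g e))
          ((fundamentalLatticeRep 2).driftLie β (matrixConfig (fundamentalLatticeRep 2).ρ V) e *
            (fundamentalLatticeRep 2).ρ (V e)) +
        -(3 / 2) * hsForm (fundamentalLatticeRep 2).N ((fundamentalLatticeRep 2).ρ (g e))
          ((fundamentalLatticeRep 2).ρ (V e)) := by
      rw [latticeLangevinDynamics_drift, Matrix.add_mul, map_add, hsForm_casimir_two_mul]
      rfl
    have hs' : s e = hsForm (fundamentalLatticeRep 2).N ((fundamentalLatticeRep 2).ρ (g e))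
        ((fundamentalLatticeRep 2).ρ (V e)) / 2 := rfl
    have hd' : hsForm 2 (fundamentalRep (Fin 2) (g e)) ((latticeLangevinDynamics (fundamentalLatticeRep 2) β).drift
        (matrixConfig (fundamentalRep (Fin 2)) V) e) = hsForm (fundamentalLatticeRep 2).N
          ((fundamentalLatticeRep 2).ρ (g e)) ((latticeLangevinDynamics (fundamentalLatticeRep 2) β).drift
            (matrixConfig (fundamentalLatticeRep 2).ρ V) e) := rfl
    rw [hd', hd, hs']
    ring
  -- SECOND-ORDER PART
  -- `ℓ σₙ` is supported on the link of `n`, with coefficient `½ ⟨ρ g_e, noise⟩`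
  have hℓσ : ∀ k : Edge 3 L × NoiseIdx 2, ℓ (fun i => σ i k) =
      (hsForm 2 (fundamentalRep (Fin 2) (g k.1)) ((latticeLangevinDynamics (fundamentalLatticeRep 2) β).noise
        (matrixConfig (fundamentalRep (Fin 2)) V) k.1 k.2) / 2) • (Pi.single k.1 1 : Edge 3 L → ℝ) := by
    intro k
    set Mk : Edge 3 L → Matrix (Fin 2) (Fin 2) ℂ := fun e => if k.1 = e then
      (latticeLangevinDynamics (fundamentalLatticeRep 2) β).noise (matrixConfig (fundamentalRep (Fin 2)) V) e k.2
      else 0 with hMk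
    have hM := hlatM Mk
    have hσk : (fun i => σ i k) = fun q => (fun z : ℂ => if q.2.2.2 then z.im else z.re) (Mk q.1 q.2.1 q.2.2.1) := by
      funext q
      rcases q with ⟨e', i, j, c⟩
      simp only [σ, hMk]
      cases c <;> by_cases hk : k.1 = e' <;> simp [hk]
    rw [hσk]
    funext e
    rw [hM e, Pi.smul_apply, smul_eq_mul, hMk]
    by_cases hke : k.1 = e
    · dsimp only
      rw [if_pos hke]
      subst hke
      rw [Pi.single_eq_same, mul_one]
    · dsimp only
      rw [if_neg hke, Pi.single_eq_of_ne (Ne.symm hke)]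
      simp [hsForm_apply]
  -- the bilinear rearrangement `Σᵢⱼ D2(ℓeⱼ)(ℓeᵢ) Σₙ σᵢₙσⱼₙ = Σₙ D2(ℓσₙ)(ℓσₙ)`
  have hbil : ∑ i, ∑ j, D2 (ℓ (Pi.single j 1)) (ℓ (Pi.single i 1)) * ∑ n, σ i n * σ j n =
      ∑ n, D2 (ℓ (fun i => σ i n)) (ℓ (fun i => σ i n)) := by
    have hexp : ∀ n, ℓ (fun i => σ i n) = ∑ i, σ i n • ℓ (Pi.single i 1) := by
      intro n
      conv_lhs => rw [pi_eq_sum_univ' (fun i => σ i n), map_sum]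
      exact Finset.sum_congr rfl fun i _ => by rw [map_smul]
    have hrhs : ∀ n, D2 (ℓ (fun i => σ i n)) (ℓ (fun i => σ i n)) =
        ∑ i, ∑ j, σ i n * σ j n * D2 (ℓ (Pi.single j 1)) (ℓ (Pi.single i 1)) := by
      intro n
      rw [hexp n]
      exact bilin_sum_smul_sum_smul D2 (fun i => ℓ (Pi.single i 1)) (fun i => σ i n)
    simp_rw [hrhs, Finset.mul_sum]
    conv_rhs => rw [Finset.sum_comm]
    refine Finset.sum_congr rfl fun i _ => ?_
    conv_rhs => rw [Finset.sum_comm]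
    refine Finset.sum_congr rfl fun j _ => Finset.sum_congr rfl fun n _ => ?_
    ring
  -- the link sums of squared coefficients: `Σₘ (½⟨ρ g_e, noise_{e,m}⟩)² = 1 - s_e²`
  have hcoef : ∀ e : Edge 3 L, ∑ m : NoiseIdx 2,
      (hsForm 2 (fundamentalRep (Fin 2) (g e)) ((latticeLangevinDynamics (fundamentalLatticeRep 2) β).noise
        (matrixConfig (fundamentalRep (Fin 2)) V) e m) / 2) ^ 2 = 1 - s e ^ 2 := by
    intro e
    have hsq : ∑ m : NoiseIdx 2, hsForm (fundamentalLatticeRep 2).N ((fundamentalLatticeRep 2).ρ (g e))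
        ((fundamentalLatticeRep 2).lieProj (noiseDir m) * (fundamentalLatticeRep 2).ρ (V e)) ^ 2 =
        2 * (1 - (hsForm (fundamentalLatticeRep 2).N ((fundamentalLatticeRep 2).ρ (g e))
          ((fundamentalLatticeRep 2).ρ (V e)) / 2) ^ 2) := sum_hsForm_lieProj_noiseDir_mul_sq (g e) (V e)
    have hnoise : ∀ m : NoiseIdx 2, hsForm 2 (fundamentalRep (Fin 2) (g e))
        ((latticeLangevinDynamics (fundamentalLatticeRep 2) β).noise (matrixConfig (fundamentalRep (Fin 2)) V) e m) =
        Real.sqrt 2 * hsForm (fundamentalLatticeRep 2).N ((fundamentalLatticeRep 2).ρ (g e))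
          ((fundamentalLatticeRep 2).lieProj (noiseDir m) * (fundamentalLatticeRep 2).ρ (V e)) := by
      intro m
      rw [latticeLangevinDynamics_noise]
      exact hsForm_coe_smul_right (Real.sqrt 2) _ _
    simp_rw [hnoise]
    have h2 : ∀ a : ℝ, (Real.sqrt 2 * a / 2) ^ 2 = a ^ 2 / 2 := fun a => by
      rw [div_pow, mul_pow, Real.sq_sqrt (by norm_num : (0:ℝ) ≤ 2)]; ring
    simp_rw [h2]
    rw [← Finset.sum_div, hsq]
    change 2 * (1 - (s e) ^ 2) / 2 = 1 - s e ^ 2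
    ring
  have hsecond : ∑ n, D2 (ℓ (fun i => σ i n)) (ℓ (fun i => σ i n)) =
      ∑ e, (1 - s e ^ 2) * D2 (Pi.single e 1) (Pi.single e 1) := by
    simp_rw [hℓσ, map_smul, _root_.smul_apply, smul_eq_mul]
    rw [Fintype.sum_prod_type]
    refine Finset.sum_congr rfl fun e _ => ?_
    rw [← hcoef e, Finset.sum_mul]
    refine Finset.sum_congr rfl fun m _ => ?_
    ring
  rw [hfirst, clm_apply_eq_sum, hbil, hsecond, Finset.mul_sum, ← Finset.sum_add_distrib]
  refine Finset.sum_congr rfl fun e _ => ?_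
  rw [hℓb e, hD2, ← fderiv_fderiv_apply_const hΦ s (Pi.single e 1) (Pi.single e 1)]
  ring

end Summit.QuantumFields.YangMills.Theorems.ColdStartUniversality

end
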